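import Summits.SmoothPoincare4.SmoothPoincare4.Theorems.InformationMetricHadamardAhHadamardFillingFisherSphereGaussDefs

/-!
# Topological transfer of a collar to a model of the moduli space
(crux `InformationMetricHadamard.AhHadamardFilling`, item stmt-SmoothPoincare4-6014, line
`fisher-sphere-gauss`, stub F `stub_instantonCollarPackage` — the Donaldson–Taubes collar of a model
of the charge-one instanton moduli space). This file is the point-set-topological part of stub F.

Setting. `Ψ : N × ℝ → M` is a collar of a space `M` over the scale interval `(0, l₀)`: continuous
and injective on `N × (0, l₀)`, with co-compact far parts `Ψ(N × (0,t))` and such that the closure of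
`Ψ(N × (0,s))` stays inside `Ψ(N × (0,t))` for `s < t`. A MODEL of `M` is an open topological
embedding `ι : W → M` with closed range (so `range ι` is clopen, a union of components) meeting the
collar. Since `N` is connected the whole collar lies in `range ι`, and the map `Φ : N × ℝ → W`
determined on `N × (0,1)` by `ι (Φ (σ, l)) = Ψ (σ, f l)` with the scale reparametrisation
`f l = l₀ l / (l₀ + l)` (a strictly increasing bijection `(0,1) → (0, l₀/(l₀+1))` with explicit
inverse `m ↦ l₀ m / (l₀ − m)`) is a collar of `W` over `(0,1)`: `helper_collarTopologyTransfer`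
proves that it is continuous and injective on `N × (0,1)`, that its far parts are co-compact and
that the closure of `Φ(N × (0,t))`, `t < 1`, stays inside `Φ(N × (0,1))`. The key step is the set
identity `Φ(N × (0,t)) = ι⁻¹(Ψ(N × (0, f t)))` for `0 < t ≤ 1` (`image_collar_eq_preimage`), after
which co-compactness is `IsInducing.isCompact_preimage` (closed range) and the closure clause is
`closure (ι⁻¹ S) ⊆ ι⁻¹ (closure S)`.
Authorship: stub-worker of the line lead prover-line-stmt-SmoothPoincare4-6014-c5-0 (wave 1).

References: elementary point-set topology (Bourbaki, *General Topology* I §11 (connected sets and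
clopen sets), I §10 (proper maps / closed embeddings)). [folklore]
-/

noncomputable section

-- the prescribed namespace `Summit.<P>.<Sub>.…` duplicates `SmoothPoincare4` (P = Sub)
set_option linter.dupNamespace false

open scoped Topology
open Set Function Topology Filter

namespace Summit.SmoothPoincare4.SmoothPoincare4.Cruxes.AhHadamardFilling.FisherSphereGauss

/-! ## The scale reparametrisation `l ↦ l₀ l / (l₀ + l)` -/

/-- The reparametrised scale `l₀ l / (l₀ + l)` is positive for `l₀, l > 0`. [folklore] -/
theorem collarScale_pos {l₀ l : ℝ} (hl₀ : 0 < l₀) (hl : 0 < l) : 0 < l₀ * l / (l₀ + l) := by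
  positivity

/-- The reparametrised scale `l₀ l / (l₀ + l)` stays below `l₀` for `l₀, l > 0`. [folklore] -/
theorem collarScale_lt_self {l₀ l : ℝ} (hl₀ : 0 < l₀) (hl : 0 < l) : l₀ * l / (l₀ + l) < l₀ := by
  rw [div_lt_iff₀ (by positivity)]
  nlinarith

/-- The reparametrisation `l ↦ l₀ l / (l₀ + l)` is strictly increasing on `(0, ∞)`. [folklore] -/
theorem collarScale_lt_collarScale {l₀ a b : ℝ} (hl₀ : 0 < l₀) (ha : 0 < a) (hab : a < b) :
    l₀ * a / (l₀ + a) < l₀ * b / (l₀ + b) := by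
  rw [div_lt_div_iff₀ (by positivity) (by linarith)]
  nlinarith [mul_pos (mul_pos hl₀ hl₀) (sub_pos.2 hab)]

/-- The reparametrisation `l ↦ l₀ l / (l₀ + l)` is injective on `(0, ∞)`. [folklore] -/
theorem collarScale_injOn {l₀ : ℝ} (hl₀ : 0 < l₀) :
    InjOn (fun l : ℝ ↦ l₀ * l / (l₀ + l)) (Ioi 0) := by
  have hmono : StrictMonoOn (fun l : ℝ ↦ l₀ * l / (l₀ + l)) (Ioi 0) :=
    fun a ha b _ hab ↦ collarScale_lt_collarScale hl₀ ha hab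
  exact hmono.injOn

/-- The reparametrisation `l ↦ l₀ l / (l₀ + l)` maps `(0, t)` ONTO `(0, l₀ t / (l₀ + t))`: every
`m` in the latter interval is `l₀ l / (l₀ + l)` for `l = l₀ m / (l₀ - m) ∈ (0, t)`. [folklore] -/
theorem exists_collarScale_eq {l₀ t m : ℝ} (hl₀ : 0 < l₀) (ht : 0 < t) (hm : 0 < m)
    (hmt : m < l₀ * t / (l₀ + t)) :
    ∃ l ∈ Ioo (0 : ℝ) t, l₀ * l / (l₀ + l) = m := by
  have hml₀ : m < l₀ := hmt.trans (collarScale_lt_self hl₀ ht)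
  have h1 : 0 < l₀ - m := sub_pos.2 hml₀
  refine ⟨l₀ * m / (l₀ - m), ⟨by positivity, ?_⟩, ?_⟩
  · rw [div_lt_iff₀ h1]
    rw [lt_div_iff₀ (by positivity)] at hmt
    nlinarith
  · have h2 : l₀ + l₀ * m / (l₀ - m) = l₀ * l₀ / (l₀ - m) := by
      field_simp
      ring
    rw [h2, ← mul_div_assoc, div_div_div_cancel_right₀ h1.ne', mul_div_mul_left _ _ hl₀.ne',
      mul_div_cancel_left₀ _ hl₀.ne']

/-! ## The collar in the model -/

/-- **Key set identity.** If `ι` is injective and `ι (Φ p) = Ψ (p.1, l₀ p.2 / (l₀ + p.2))` on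
`N × (0,1)`, then for `0 < t ≤ 1` the far part `Φ(N × (0,t))` is the `ι`-preimage of the far part
`Ψ(N × (0, l₀ t / (l₀ + t)))` (surjectivity of the reparametrisation onto `(0, l₀ t/(l₀+t))` and
injectivity of `ι` give `⊇`). [folklore] -/
theorem image_collar_eq_preimage
    {N : Type*} {M : Type*} {W : Type*} {ι : W → M} (hinj : Injective ι)
    {Ψ : N × ℝ → M} {l₀ : ℝ} (hl₀ : 0 < l₀) {Φ : N × ℝ → W}
    (hΦ : ∀ p ∈ (univ : Set N) ×ˢ Ioo (0 : ℝ) 1, ι (Φ p) = Ψ (p.1, l₀ * p.2 / (l₀ + p.2)))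
    {t : ℝ} (ht : t ∈ Ioc (0 : ℝ) 1) :
    Φ '' (univ ×ˢ Ioo (0 : ℝ) t) = ι ⁻¹' (Ψ '' (univ ×ˢ Ioo (0 : ℝ) (l₀ * t / (l₀ + t)))) := by
  ext w
  constructor
  · rintro ⟨⟨σ, l⟩, ⟨-, hl⟩, rfl⟩
    have hl1 : (σ, l) ∈ (univ : Set N) ×ˢ Ioo (0 : ℝ) 1 := ⟨mem_univ _, hl.1, hl.2.trans_le ht.2⟩
    have key : ι (Φ (σ, l)) = Ψ (σ, l₀ * l / (l₀ + l)) := hΦ _ hl1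
    rw [mem_preimage, key]
    exact ⟨(σ, l₀ * l / (l₀ + l)),
      ⟨mem_univ _, collarScale_pos hl₀ hl.1, collarScale_lt_collarScale hl₀ hl.1 hl.2⟩, rfl⟩
  · rintro ⟨⟨σ, m⟩, ⟨-, hm⟩, hw⟩
    obtain ⟨l, hl, hlm⟩ := exists_collarScale_eq hl₀ ht.1 hm.1 hm.2
    have hl1 : (σ, l) ∈ (univ : Set N) ×ˢ Ioo (0 : ℝ) 1 := ⟨mem_univ _, hl.1, hl.2.trans_le ht.2⟩
    have key : ι (Φ (σ, l)) = Ψ (σ, m) := by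
      have h := hΦ _ hl1
      dsimp only at h
      rw [h, hlm]
    exact ⟨(σ, l), ⟨mem_univ _, hl⟩, hinj (key.trans hw)⟩

/-- **Topological transfer of a collar to a model** (helper of stub F
`stub_instantonCollarPackage`). Let `ι : W → M` be an open embedding with closed range, and
`Ψ : N × ℝ → M` (`N` connected) a collar over `(0, l₀)`: continuous and injective on `N × (0,l₀)`,
meeting `range ι`, with co-compact far parts `Ψ(N × (0,t))` (`0 < t < l₀`) and
`closure Ψ(N × (0,s)) ⊆ Ψ(N × (0,t))` for `0 < s < t < l₀`. If `Φ : N × ℝ → W` satisfies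
`ι (Φ (σ,l)) = Ψ (σ, l₀ l/(l₀+l))` on `N × (0,1)`, then: (1) the whole collar `Ψ(N × (0,l₀))` lies
in `range ι` (it is connected and `range ι` is clopen); (2) `Φ` is continuous on `N × (0,1)` (`ι` is
inducing and `ι ∘ Φ = Ψ ∘ (id × f)` there); (3) `Φ` is injective on `N × (0,1)` (`Ψ` and `f` are);
(4) the far parts `Φ(N × (0,t))`, `0 < t < 1`, are co-compact (`Φ(N × (0,t)) = ι⁻¹ Ψ(N × (0,f t))`
and preimages of compact sets under a closed-range embedding are compact); (5)
`closure Φ(N × (0,t)) ⊆ Φ(N × (0,1))` for `0 < t < 1` (continuity of `ι` and the closure clause of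
`Ψ` with `f t < f 1 < l₀`). [folklore] -/
theorem helper_collarTopologyTransfer
    {N : Type*} [TopologicalSpace N] [ConnectedSpace N]
    {M : Type*} [TopologicalSpace M] {W : Type*} [TopologicalSpace W]
    {ι : W → M} (hι : IsOpenEmbedding ι) (hcl : IsClosed (range ι))
    {Ψ : N × ℝ → M} {l₀ : ℝ} (hl₀ : 0 < l₀)
    (hΨc : ContinuousOn Ψ (univ ×ˢ Ioo 0 l₀)) (hΨi : InjOn Ψ (univ ×ˢ Ioo 0 l₀))
    (hmeet : ∃ p ∈ (univ : Set N) ×ˢ Ioo (0 : ℝ) l₀, Ψ p ∈ range ι)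
    (hco : ∀ t ∈ Ioo (0 : ℝ) l₀, IsCompact (Ψ '' (univ ×ˢ Ioo (0 : ℝ) t))ᶜ)
    (hclo : ∀ s t : ℝ, 0 < s → s < t → t < l₀ →
      closure (Ψ '' (univ ×ˢ Ioo (0 : ℝ) s)) ⊆ Ψ '' (univ ×ˢ Ioo (0 : ℝ) t))
    {Φ : N × ℝ → W}
    (hΦ : ∀ p ∈ (univ : Set N) ×ˢ Ioo (0 : ℝ) 1, ι (Φ p) = Ψ (p.1, l₀ * p.2 / (l₀ + p.2))) :
    (∀ p ∈ (univ : Set N) ×ˢ Ioo (0 : ℝ) l₀, Ψ p ∈ range ι) ∧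
    ContinuousOn Φ (univ ×ˢ Ioo (0 : ℝ) 1) ∧ InjOn Φ (univ ×ˢ Ioo (0 : ℝ) 1) ∧
    (∀ t ∈ Ioo (0 : ℝ) 1, IsCompact (Φ '' (univ ×ˢ Ioo (0 : ℝ) t))ᶜ) ∧
    (∀ t ∈ Ioo (0 : ℝ) 1, closure (Φ '' (univ ×ˢ Ioo (0 : ℝ) t)) ⊆ Φ '' (univ ×ˢ Ioo (0 : ℝ) 1)) := by
  -- the reparametrisation maps `N × (0,1)` into `N × (0, l₀)`
  have hmaps : MapsTo (fun p : N × ℝ ↦ (p.1, l₀ * p.2 / (l₀ + p.2)))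
      ((univ : Set N) ×ˢ Ioo (0 : ℝ) 1) (univ ×ˢ Ioo (0 : ℝ) l₀) := fun p hp ↦
    ⟨mem_univ _, collarScale_pos hl₀ hp.2.1, collarScale_lt_self hl₀ hp.2.1⟩
  -- (1) the whole collar lies in the clopen set `range ι`
  have h1 : ∀ p ∈ (univ : Set N) ×ˢ Ioo (0 : ℝ) l₀, Ψ p ∈ range ι := by
    have hpc' : IsPreconnected ((univ : Set N) ×ˢ Ioo (0 : ℝ) l₀) :=
      isPreconnected_univ.prod isPreconnected_Ioo
    have hpc : IsPreconnected (Ψ '' (univ ×ˢ Ioo (0 : ℝ) l₀)) := hpc'.image Ψ hΨc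
    obtain ⟨p₀, hp₀, hp₀r⟩ := hmeet
    have hsub : Ψ '' (univ ×ˢ Ioo (0 : ℝ) l₀) ⊆ range ι :=
      hpc.subset_isClopen ⟨hcl, hι.isOpen_range⟩ ⟨Ψ p₀, mem_image_of_mem Ψ hp₀, hp₀r⟩
    exact fun p hp ↦ hsub (mem_image_of_mem Ψ hp)
  refine ⟨h1, ?_, ?_, ?_, ?_⟩
  · -- (2) continuity: `ι` is inducing and `ι ∘ Φ = Ψ ∘ (id × f)` on the domain
    rw [hι.isInducing.continuousOn_iff]
    have hg : ContinuousOn (fun p : N × ℝ ↦ (p.1, l₀ * p.2 / (l₀ + p.2)))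
        ((univ : Set N) ×ˢ Ioo (0 : ℝ) 1) := by
      refine continuousOn_fst.prodMk ?_
      exact ContinuousOn.div₀ (continuousOn_const.mul continuousOn_snd)
        (continuousOn_const.add continuousOn_snd) fun p hp ↦ (add_pos hl₀ hp.2.1).ne'
    exact (hΨc.comp hg hmaps).congr fun p hp ↦ hΦ p hp
  · -- (3) injectivity: `Ψ` is injective on `N × (0,l₀)` and `f` is injective on `(0, ∞)`
    rintro ⟨σ, a⟩ ha ⟨τ, b⟩ hb hab
    have hΨab : Ψ (σ, l₀ * a / (l₀ + a)) = Ψ (τ, l₀ * b / (l₀ + b)) := by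
      have h₁ := hΦ _ ha
      have h₂ := hΦ _ hb
      dsimp only at h₁ h₂
      rw [← h₁, ← h₂, hab]
    have hst : (σ, l₀ * a / (l₀ + a)) = (τ, l₀ * b / (l₀ + b)) := hΨi (hmaps ha) (hmaps hb) hΨab
    simp only [Prod.mk.injEq] at hst
    obtain ⟨rfl, hfab⟩ := hst
    have ha0 : a ∈ Ioi (0 : ℝ) := ha.2.1
    have hb0 : b ∈ Ioi (0 : ℝ) := hb.2.1
    rw [collarScale_injOn hl₀ ha0 hb0 hfab]
  · -- (4) co-compactness of the far parts
    intro t ht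
    rw [image_collar_eq_preimage hι.injective hl₀ hΦ ⟨ht.1, ht.2.le⟩, ← preimage_compl]
    exact hι.isInducing.isCompact_preimage hcl
      (hco _ ⟨collarScale_pos hl₀ ht.1, collarScale_lt_self hl₀ ht.1⟩)
  · -- (5) the closure clause
    intro t ht
    rw [image_collar_eq_preimage hι.injective hl₀ hΦ ⟨ht.1, ht.2.le⟩,
      image_collar_eq_preimage hι.injective hl₀ hΦ ⟨one_pos, le_rfl⟩]
    refine (hι.continuous.closure_preimage_subset _).trans (preimage_mono ?_)
    exact hclo _ _ (collarScale_pos hl₀ ht.1) (collarScale_lt_collarScale hl₀ ht.1 ht.2)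
      (collarScale_lt_self hl₀ one_pos)

end Summit.SmoothPoincare4.SmoothPoincare4.Cruxes.AhHadamardFilling.FisherSphereGauss
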